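import Summits.ResolutionOfSingularities.ResolutionOfSingularities.Theses.EquisingularLift
import HarnessLib

/-!
# W4.5b bookkeeping glue: the `∀ n` working crux `EquisingularLiftNat` specialises to its `n = 3` child `EquisingularLiftNatThree`

[OURS · L1 W4.5b] Route `ResolutionOfSingularities/EquisingularLift`; line of record = the route file's items
`stmt-ResolutionOfSingularities-20038` (`EquisingularLiftNat`, the `∀ n` working crux) and `stmt-ResolutionOfSingularities-20148`
(`EquisingularLiftNatThree`, its `n = 3` child; CHAIN header GLUE).  Verbatim land of the glue theorem of res-L1-w45b-plan-1's
`L/w45b/EL3-split-item.lean` (the local `def` dropped: both Props are route decls of `Theses/EquisingularLift.lean` rev 4, used BY NAME),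
on the W4.5b desk's word (STATUS 2026-08-27T20:41:25Z, custody DEAL #77), landed by res-L1-type-o4 with
`--supports stmt-ResolutionOfSingularities-20148 --as helper`.  Bookkeeping only — NOT a statement of H. Hironaka's 2017 manuscript (under
adjudication; nothing of it is asserted or used), not progress on either crux: the `n = 3` statement is literally the `∀ n` statement followed
by the extra hypothesis `n = 3`, which the proof discards.  AI-written, weaker than expert review.  No definition; no new axiom.
-/

set_option linter.dupNamespace false -- mandated namespace of this single-conjunct summit

namespace Summit.ResolutionOfSingularities.ResolutionOfSingularities.Theses.EquisingularLift

/-- [OURS · L1 W4.5b] bookkeeping glue: the `∀ n` working crux `EquisingularLiftNat` (stmt-ResolutionOfSingularities-20038) specialises to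
the `n = 3` child `EquisingularLiftNatThree` (stmt-ResolutionOfSingularities-20148) — CHAIN header GLUE; not a statement of the manuscript. -/
theorem equisingularLiftNatThree_of_nat (h : EquisingularLiftNat) : EquisingularLiftNatThree := by
  intro p hp k _ _ _ n H ι hι hH hloc _
  exact h p hp k n H ι hι hH hloc

end Summit.ResolutionOfSingularities.ResolutionOfSingularities.Theses.EquisingularLift
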